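import Summits.CriticalPhenomena.PercolationContinuityZ3.Theorems.Transplant.SkelPhiParaCorridorKGY
import HarnessLib

/-!
# N2 (frames-only node `SamePDropOfSkeletonFrm₁`, OPEN), (R) column, (R-38) second axis: **THE SECOND CROSS LINK `hx₂` FROM FOUR NUMERIC ROWS** —
# `Skelφ.runX_mem_kgCorrSchedY_core_zero_of_runX`

The row `hx₂` of the second-axis root skeleton (`NegB.rootLegAt_frmQ3D_snd` p356852): a vertex read by the run frame at the FIRST landing `c₁` inside a
box `[lo, hi]` (the x-prefix's last core `[kgLastLo, kgLastHi]`) is read by the run frame at the SECOND landing `c₂` (same map, period, shear) inside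
the y′-corridor's start core `core 0 = {|y 1| ≤ q} × [−((n+v)⁺ + W), (n−v)⁺ + W]` (`mem_kgCorrSchedY_core_zero`), PROVIDED the frame-change offsets
`X₁₂ := φ c₂ 0 − φ c₁ 0` and `S₁₂ := n·(φ c₂ 1 − φ c₁ 1) − h·(φ c₂ 0 − φ c₁ 0)` satisfy: `−((n+v)⁺ + W) ≤ lo 0 − X₁₂`, `hi 0 − X₁₂ ≤ (n−v)⁺ + W`
(coordinate 0 is EXACT and additive), `−q·U ≤ lo 1·U − S₁₂` and `(hi 1 + 1)·U − S₁₂ ≤ (q + 1)·U` (coordinate 1 is the floor `⌊s/U⌋` of the shear sum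
`s`, which changes by exactly `−S₁₂` between the frames; one unit of rounding).  Cell-free; for stmt's second-landing lemma.
builds on p205010 (kernel theorem, internal audit signed; external expert review pending) — nothing in this file uses p205010; nothing here is a claim
about the open node `SamePDropOfSkeletonFrm₁`.
Lane `prim-bschramm`, seat `prim-bschramm-p3` (gen 16; N2 design owner, (R) column owner); helper file (`--supports stmt-CriticalPhenomena-4575 --as helper`).
[cite: KozmaNitzan2024, §4 Lemma 11 (p. 22), Lemma 12 (pp. 23–25)] [cite: MartineauTassion2017, §3.2]
-/

noncomputable section

namespace Summit.CriticalPhenomena.PercolationContinuityZ3.Theorems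

namespace Transplant

namespace Skelφ

open Literature.Probability.Percolation Literature.Probability.LatticeModels SimpleGraph
open ChainPlanar ChainPara

variable {V : Type} {φ : V → Site 2}

variable {n ℓ : ℕ} {h v : ℤ} {R' ρ q W N m₁ Wm₂ Wp₂ m₂ : ℕ} (hn : 1 ≤ n) (hv : |v| ≤ n) (hlay : (n + h.natAbs : ℕ) ≤ (n : ℤ) * ℓ + 1)
  (hP₁ : ParkOK (kgPark₁Y n ℓ h v R' ρ q W N m₁)) (hP₂ : ParkOK (kgPark₂Y n ℓ h v R' ρ q W N m₁ Wm₂ Wp₂ m₂))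
  (hsplit : (Wm₂ : ℤ) + Wp₂ = (kgPark₁Y n ℓ h v R' ρ q W N m₁).aHi (m₁ + 1) - ParkPrm.aLo (kgPark₁Y n ℓ h v R' ρ q W N m₁) (m₁ + 1))

include hn hv hlay hP₁ hP₂ hsplit in
/-- **THE SECOND CROSS LINK FROM FOUR NUMERIC ROWS** (see the module docstring). [cite: KozmaNitzan2024, §4 Lemma 11 (p. 22)] -/
theorem runX_mem_kgCorrSchedY_core_zero_of_runX (c₁ c₂ : V) {X₁₂ S₁₂ : ℤ} (hX : φ c₂ 0 - φ c₁ 0 = X₁₂)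
    (hS : (n : ℤ) * (φ c₂ 1 - φ c₁ 1) - h * (φ c₂ 0 - φ c₁ 0) = S₁₂)
    {lo hi : Site 2} (hx0 : -((((n + v).toNat + W : ℕ)) : ℤ) ≤ lo 0 - X₁₂) (hx1 : hi 0 - X₁₂ ≤ (((n - v).toNat + W : ℕ) : ℤ))
    (hr₁ : -((q : ℤ) * (shearUnit n h : ℤ)) ≤ lo 1 * (shearUnit n h : ℤ) - S₁₂)
    (hr₂ : (hi 1 + 1) * (shearUnit n h : ℤ) - S₁₂ ≤ ((q : ℤ) + 1) * (shearUnit n h : ℤ))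
    {w : V} (hw : runX φ c₁ n h 1 w ∈ Finset.Icc lo hi) :
    runX φ c₂ n h 1 w ∈ (kgCorrSchedY hn hv hlay hP₁ hP₂ hsplit).core 0 := by
  have hU : 0 < (shearUnit n h : ℤ) := shearUnit_pos hn h
  obtain ⟨hlo, hhi⟩ := Finset.mem_Icc.1 hw
  have h0lo := hlo 0
  have h0hi := hhi 0
  have h1lo := hlo 1
  have h1hi := hhi 1
  rw [runX_zero, relCoord_apply, one_mul] at h0lo h0hi
  rw [runX_one, shearCoord_apply, one_mul] at h1lo h1hi
  -- the shear sum at `c₁`, squeezed by its floor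
  set s₁ : ℤ := (n : ℤ) * (φ w 1 - φ c₁ 1) - h * (φ w 0 - φ c₁ 0) with hs₁
  have hsl : lo 1 * (shearUnit n h : ℤ) ≤ s₁ := le_trans (mul_le_mul_of_nonneg_right h1lo hU.le) (Int.ediv_mul_le s₁ hU.ne')
  have hsu : s₁ < (hi 1 + 1) * (shearUnit n h : ℤ) :=
    lt_of_lt_of_le (Int.lt_ediv_add_one_mul_self s₁ hU) (mul_le_mul_of_nonneg_right (by linarith) hU.le)
  -- the shear sum at `c₂` differs by `S₁₂`
  have hs₂ : (n : ℤ) * (φ w 1 - φ c₂ 1) - h * (φ w 0 - φ c₂ 0) = s₁ - S₁₂ := by rw [hs₁, ← hS]; ring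
  rw [mem_kgCorrSchedY_core_zero hn hv hlay hP₁ hP₂ hsplit, runX_zero, runX_one, relCoord_apply, shearCoord_apply, one_mul, one_mul, hs₂]
  refine ⟨⟨Int.le_ediv_of_mul_le hU (by linarith), ?_⟩, ⟨by linarith, by linarith⟩⟩
  have hlt : (s₁ - S₁₂) / (shearUnit n h : ℤ) < (q : ℤ) + 1 := (Int.ediv_lt_iff_lt_mul hU).2 (by linarith)
  omega

end Skelφ

end Transplant

end Summit.CriticalPhenomena.PercolationContinuityZ3.Theorems

end
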